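import Summits.AtomisticToContinuum.Crystallization.Theorems.ChargedEnergyGap.Negative.Unconditional
import Summits.AtomisticToContinuum.Crystallization.Theorems.PhononSlackCertificatesAllBadGapFloor

/-!
# The energy budget of Lennard-Jones ground states: `0 ≤ 𝓔(x^N) − N·e* = o(N)`

Crux `SquareWellLayerCake.GapTwelveToBarlow` (stmt-AtomisticToContinuum-15807), line `Sketch`,
helper for the energetic stubs `stub_relaxedRigidity` / `stub_uniformSpacing` (card
`estar-absorbing-priced-pieces`): the ONLY two uses of minimality the line makes are the floor
`N·e* ≤ 𝓔_LJ(y)` for every injective `y` (tree: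
`PhononSlackCertificatesAllBadGapFloor.card_mul_iInf_le_interactionEnergy`) and the trial bound
`E(N)/N → e*` (tree: `ChargedEnergyGapNegative.crysEnergyLimit`).  Packaged here for a ground-state
sequence `x` (`𝓔(x^N) = E(N)`):

* `excess_nonneg` — `0 ≤ 𝓔(x^N) − N·e*`;
* `tendsto_excess_div` — `(𝓔(x^N) − N·e*)/N → 0`;
* `stub_groundStateBudget` — registered closed form (both facts).

`e* := ⨅_Q e(Q)` over periodic configurations.  No named fact is used.
-/

noncomputable section

namespace Summit.AtomisticToContinuum.Crystallization.Theorems.SquareWellLayerCakeGapTwelveToBarlow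

open Filter Literature.MathematicalPhysics.StatisticalMechanics

/-- The excess of a ground state over the periodic floor is non-negative: `N·e* ≤ 𝓔(x)`.
[folklore] -/
theorem excess_nonneg {N : ℕ} {x : Fin N → EuclideanSpace ℝ (Fin 3)}
    (hx : IsGroundState lennardJones x) :
    0 ≤ interactionEnergy lennardJones x -
      (N : ℝ) * (⨅ Q : PeriodicConfiguration 3, Q.energyPerParticle lennardJones) :=
  sub_nonneg.2 (PhononSlackCertificatesAllBadGapFloor.card_mul_iInf_le_interactionEnergy hx.1)

/-- The excess per particle of a ground-state sequence tends to zero: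
`(𝓔(x^N) − N·e*)/N = E(N)/N − e* → 0`. [folklore] -/
theorem tendsto_excess_div (x : (N : ℕ) → (Fin N → EuclideanSpace ℝ (Fin 3)))
    (hx : ∀ N, IsGroundState lennardJones (x N)) :
    Tendsto (fun N : ℕ => (interactionEnergy lennardJones (x N) -
        (N : ℝ) * (⨅ Q : PeriodicConfiguration 3, Q.energyPerParticle lennardJones)) / N)
      atTop (nhds 0) := by
  set eStar : ℝ := ⨅ Q : PeriodicConfiguration 3, Q.energyPerParticle lennardJones with heStar
  have hlim : Tendsto (fun N : ℕ => groundStateEnergy lennardJones 3 N / N - eStar) atTop (nhds 0) := by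
    have h := (ChargedEnergyGapNegative.crysEnergyLimit).sub_const eStar
    rwa [sub_self] at h
  refine hlim.congr' ?_
  filter_upwards [eventually_ge_atTop 1] with N hN
  have hN : (N : ℝ) ≠ 0 := by exact_mod_cast (Nat.one_le_iff_ne_zero.1 hN)
  rw [← (hx N).2, sub_div, mul_div_cancel_left₀ _ hN]

/-- **Registered closed form**: for every sequence of Lennard-Jones ground states, every excess
`𝓔(x^N) − N·e*` is non-negative and the excess per particle tends to zero. [folklore] -/
theorem stub_groundStateBudget :
    ∀ x : (N : ℕ) → (Fin N → EuclideanSpace ℝ (Fin 3)),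
      (∀ N, IsGroundState lennardJones (x N)) →
      (∀ N : ℕ, 0 ≤ interactionEnergy lennardJones (x N) -
        (N : ℝ) * (⨅ Q : PeriodicConfiguration 3, Q.energyPerParticle lennardJones)) ∧
      Filter.Tendsto (fun N : ℕ => (interactionEnergy lennardJones (x N) -
        (N : ℝ) * (⨅ Q : PeriodicConfiguration 3, Q.energyPerParticle lennardJones)) / N)
        Filter.atTop (nhds 0) :=
  fun x hx => ⟨fun N => excess_nonneg (hx N), tendsto_excess_div x hx⟩

end Summit.AtomisticToContinuum.Crystallization.Theorems.SquareWellLayerCakeGapTwelveToBarlow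

end
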